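import Literature.AnabelianGeometry.EtaleTheta.EtaleThetaClass
import Literature.AnabelianGeometry.EtaleTheta.LDeltaThetaIndex
import Literature.AnabelianGeometry.EtaleTheta.DoubleUnderline
import Literature.AnabelianGeometry.EtaleTheta.SingleUnderline
import Literature.AnabelianGeometry.EtaleTheta.ContH1ConjAction
import Mathlib.GroupTheory.OrderOfElement
import Mathlib.Topology.Algebra.Group.Quotient
import HarnessLib

/-!
# [EtTh] §2 in the §1 model: the étale theta class modulo `l` — coefficients `Δ̄_Θ = Δ_Θ/l·Δ_Θ`, the
# reduction of `H¹`, and the chain `Π^tp_Ÿ ≤ Π^tp_Y ≤ Π^tp_X̲`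

Mochizuki, *The étale theta function and its Frobenioid-theoretic manifestations*, Publ. RIMS **45**
(2009), §2: "`Δ̄_Θ ≅ (ℤ/lℤ)(1)`" (PRIMS PDF p. 35); Def. 2.7 (p. 41) "a specific class
`∈ H¹(Π^tp_Ÿ, Δ_Θ ⊗ ℤ/lℤ)`, which may be thought of as a choice of `η̈^Θ` up to an `(O_K^×)^l`-multiple",
"`Π^tp_X̲/Π^tp_Ÿ ≅ (l·Z) × μ₂`" [cite: MochizukiEtTh2009, Def 2.7 p.41].

Cell abc-iut, layer L2, item N3 (existence of the choice `X̲̲`; seat abc-iut-L2-t7): the bookkeeping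
over the §1 root `ThetaSetting` (seat abc-iut-L2-t1) that the companion file
`XuuCocycleOfInvariance.lean` uses to inhabit `XuuCocycleInput l` (`XuuCocycleOfCyclotome.lean`) from
the invariance of `η̈^Θ` modulo `l`:

* generic (classical, [cite: NeukirchSchmidtWingberg2008, I §2 and II §7]): `ContH1.pushCocycle` /
  `ContH1.push` — change of coefficients in the continuous `H¹` of `ContH1.lean` along a continuous
  homomorphism `ψ : G' → G''` of the AMBIENT groups (`A ↦ A''`, action through `ψ ∘ φ`), and its
  compatibility with the conjugation action (`push_conj`);
* the coefficients modulo `l`: `GtpThetaModL = (Π^tp_X)^Θ/l·Δ_Θ` (topological quotient group),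
  `DeltaThetaBar = Δ̄_Θ := Δ_Θ/l·Δ_Θ` inside it — of order `l` (`natCard_DeltaThetaBar`, from seat
  abc-iut-L2-t8's cyclotome input `CyclotomeMod 1 l`), with squaring bijective for `l` odd
  (`sq_bijective_DeltaThetaBar`) and DISCRETE (`discreteTopology_DeltaThetaBar`: `l·Δ_Θ` is open in
  `Δ_Θ` and the projection is an open map);
* the chain under `K = K̈`: a lift `t₁ ∈ Π^tp_Y ∖ Π^tp_Ÿ` of the generator of `Gal(Ÿ/Y) ≅ μ₂`
  (`[Π^tp_Y : Π^tp_Ÿ] = 2`, `DoubleUnderline.relIndex_GtpYdd_GtpY`) and the character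
  `toZDivL : Π^tp_X̲ → ℤ`, `h ↦ toZ(h)/l`, with kernel `Π^tp_Y` and a lift `t` of `1`;
* `redModL : H¹(H, Δ_Θ) → H¹(H, Δ̄_Θ)`, of exponent `l` on the target (`pow_eq_one_of_modL`), and
  `conj_redModL_etaDd_eq`: invariance of `η̈^Θ` modulo `l`-th powers under `σ` gives honest `σ`-invariance
  of `η̈^Θ mod l`.

Nothing here asserts that a `ThetaSetting` exists; typed ≠ endorsed; no side is taken on any disputed
claim.
-/

noncomputable section

namespace Literature.AnabelianGeometry.EtaleTheta

/-! ### Change of coefficients in continuous `H¹` along a homomorphism of the ambient groups -/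

namespace ContH1

section Push

variable {G G' G'' : Type*} [Group G] [TopologicalSpace G]
  [Group G'] [TopologicalSpace G'] [IsTopologicalGroup G']
  [Group G''] [TopologicalSpace G''] [IsTopologicalGroup G'']
  (φ : G →* G') (A : Subgroup G') [A.Normal] [IsMulCommutative A]
  (ψ : G' →* G'') (hψ : Continuous ψ) (A'' : Subgroup G'') [A''.Normal] [IsMulCommutative A'']
  (hA : A.map ψ ≤ A'') (H : Subgroup G)

/-- **Push-forward of continuous cocycles along a continuous homomorphism `ψ : G' → G''`** carrying the
coefficients `A` into `A''`: `f ↦ ψ ∘ f`, a cocycle for the action through `ψ ∘ φ` (used here for the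
reduction `Δ_Θ → Δ_Θ/l·Δ_Θ`). [cite: NeukirchSchmidtWingberg2008, I §2 and II §7] -/
def pushCocycle : contCocycles φ A H →* contCocycles (ψ.comp φ) A'' H where
  toFun f := ⟨fun h => ⟨ψ (f.1 h : G'), hA ⟨(f.1 h : G'), (f.1 h).2, rfl⟩⟩,
    ⟨(hψ.comp (continuous_subtype_val.comp f.2.1)).subtype_mk _, fun g h => by
      apply Subtype.ext
      have e := congrArg (fun a : A => ψ (a : G')) (f.2.2 g h)
      simpa only [Subgroup.coe_mul, MulAut.conjNormal_apply, map_mul, map_inv, MonoidHom.coe_comp,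
        Function.comp_apply] using e⟩⟩
  map_one' := Subtype.ext (funext fun h => Subtype.ext (by simp))
  map_mul' f g := Subtype.ext (funext fun h => Subtype.ext (by simp))

/-- `pushCocycle` evaluated: `(ψ_* f)(h) = ψ(f(h))`. [cite: NeukirchSchmidtWingberg2008, I §2 and II §7] -/
@[simp] theorem coe_pushCocycle_apply (f : contCocycles φ A H) (h : H) :
    (((pushCocycle φ A ψ hψ A'' hA H f).1 h : A'') : G'') = ψ (f.1 h : G') :=
  rfl

/-- **Push-forward `H¹(H, A) → H¹(H, A'')` along `ψ`** (coboundaries go to coboundaries).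
[cite: NeukirchSchmidtWingberg2008, I §2 and II §7] -/
def push : ContH1 φ A H →* ContH1 (ψ.comp φ) A'' H :=
  QuotientGroup.map _ _ (pushCocycle φ A ψ hψ A'' hA H) (by
    intro f hf
    obtain ⟨a, ha⟩ := (mem_contCoboundaries_iff _).mp (Subgroup.mem_subgroupOf.mp hf)
    refine Subgroup.mem_subgroupOf.mpr ((mem_contCoboundaries_iff _).mpr
      ⟨⟨ψ (a : G'), hA ⟨(a : G'), a.2, rfl⟩⟩, ?_⟩)
    funext h
    apply Subtype.ext
    have e := congrArg (fun b : A => ψ (b : G')) (congrFun ha h)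
    simpa only [coe_pushCocycle_apply, Subgroup.coe_mul, Subgroup.coe_inv, MulAut.conjNormal_apply,
      map_mul, map_inv, MonoidHom.coe_comp, Function.comp_apply] using e)

/-- `push` on the class of a cocycle. [cite: NeukirchSchmidtWingberg2008, I §2 and II §7] -/
theorem push_mk (f : contCocycles φ A H) :
    push φ A ψ hψ A'' hA H (QuotientGroup.mk f : ContH1 φ A H) =
      (QuotientGroup.mk (pushCocycle φ A ψ hψ A'' hA H f) : ContH1 (ψ.comp φ) A'' H) :=
  rfl

/-- **`push` commutes with the conjugation action** of `σ ∈ G` (`H` normal).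
[cite: NeukirchSchmidtWingberg2008, I §2 and II §7] -/
theorem push_conj [IsTopologicalGroup G] [H.Normal] (σ : G) (x : ContH1 φ A H) :
    push φ A ψ hψ A'' hA H (conj φ A σ x) = conj (ψ.comp φ) A'' σ (push φ A ψ hψ A'' hA H x) := by
  induction x using QuotientGroup.induction_on with
  | H f =>
    rw [conj_mk, push_mk, push_mk, conj_mk]
    congr 1
    apply Subtype.ext
    funext h
    apply Subtype.ext
    simp only [coe_pushCocycle_apply, conjCocycle_apply, MulAut.conjNormal_apply, map_mul, map_inv,
      MonoidHom.coe_comp, Function.comp_apply]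

end Push

end ContH1

open Literature.AnabelianGeometry.SemiGraphs

namespace ThetaSetting

variable {p : ℕ} [Fact p.Prime] (D : ThetaSetting p)

/-! ### The coefficients modulo `l`: `Δ̄_Θ = Δ_Θ/l·Δ_Θ ⊆ (Π^tp_X)^Θ/l·Δ_Θ` -/

section ModL

variable (l : ℕ)

/-- `(Π^tp_X)^Θ / l·Δ_Θ` — the ambient group for the coefficients "`Δ̄_Θ ≅ (ℤ/lℤ)(1)`" (p. 35), as a
topological group (quotient topology; `l·Δ_Θ` is normal in `(Π^tp_X)^Θ`).
[cite: MochizukiEtTh2009, Def 2.1 p.35] -/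
abbrev GtpThetaModL : Type := D.GtpTheta ⧸ D.lDeltaTheta l

/-- The projection `(Π^tp_X)^Θ ↠ (Π^tp_X)^Θ / l·Δ_Θ`. [cite: MochizukiEtTh2009, Def 2.1 p.35] -/
abbrev modL : D.GtpTheta →* D.GtpThetaModL l := QuotientGroup.mk' (D.lDeltaTheta l)

/-- `modL` is continuous. [cite: MochizukiEtTh2009, Def 2.1 p.35] -/
theorem continuous_modL : Continuous (D.modL l) :=
  continuous_quotient_mk'

/-- **`Δ̄_Θ := Δ_Θ / l·Δ_Θ`** ("`Δ̄_Θ ≅ (ℤ/lℤ)(1)`", p. 35), as the image of `Δ_Θ` in `(Π^tp_X)^Θ / l·Δ_Θ`.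
[cite: MochizukiEtTh2009, Def 2.1 p.35] -/
def DeltaThetaBar : Subgroup (D.GtpThetaModL l) := D.DeltaTheta.map (D.modL l)

/-- `Δ̄_Θ` is normal (image of the normal `Δ_Θ` under a surjection). [cite: MochizukiEtTh2009, Def 2.1 p.35] -/
instance DeltaThetaBar_normal : (D.DeltaThetaBar l).Normal :=
  Subgroup.Normal.map inferInstance (D.modL l) (QuotientGroup.mk'_surjective _)

/-- `Δ̄_Θ` is commutative (image of the commutative `Δ_Θ`). [cite: MochizukiEtTh2009, Def 2.1 p.35] -/
instance DeltaThetaBar_comm : IsMulCommutative (D.DeltaThetaBar l) :=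
  ⟨⟨by
    rintro ⟨_, a, ha, rfl⟩ ⟨_, b, hb, rfl⟩
    apply Subtype.ext
    change D.modL l a * D.modL l b = D.modL l b * D.modL l a
    rw [← map_mul, ← map_mul, D.ker_thetaToEll_comm a ha b hb]⟩⟩

/-- `Π^tp_X → (Π^tp_X)^Θ / l·Δ_Θ`, the composite `modL ∘ toTheta` through which `Π^tp_X` acts on `Δ̄_Θ`.
[cite: MochizukiEtTh2009, Def 2.1 p.35] -/
abbrev toThetaModL : D.PiTemp →* D.GtpThetaModL l := (D.modL l).comp D.toTheta

/-- `toThetaModL` is continuous. [cite: MochizukiEtTh2009, Def 2.1 p.35] -/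
theorem continuous_toThetaModL : Continuous (D.toThetaModL l) :=
  (D.continuous_modL l).comp D.continuous_toTheta

/-- `Δ̄_Θ` is killed by `l` ("`(ℤ/lℤ)(1)`"). [cite: MochizukiEtTh2009, Def 2.1 p.35] -/
theorem DeltaThetaBar_pow_eq_one (a : D.DeltaThetaBar l) : a ^ l = 1 := by
  obtain ⟨x, y, hy, hyx⟩ := a
  apply Subtype.ext
  change x ^ l = 1
  rw [← hyx, ← map_pow, QuotientGroup.mk'_apply, QuotientGroup.eq_one_iff]
  exact ⟨y, hy, rfl⟩

/-- `Δ_Θ → (Π^tp_X)^Θ / l·Δ_Θ`, the restriction of `modL`. [cite: MochizukiEtTh2009, Def 2.1 p.35] -/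
def modLDelta : D.DeltaTheta →* D.GtpThetaModL l := (D.modL l).comp D.DeltaTheta.subtype

/-- Its kernel is `l·Δ_Θ`. [cite: MochizukiEtTh2009, Def 2.1 p.35] -/
theorem modLDelta_ker : (D.modLDelta l).ker = (D.lDeltaTheta l).subgroupOf D.DeltaTheta := by
  ext x
  rw [MonoidHom.mem_ker, Subgroup.mem_subgroupOf]
  exact QuotientGroup.eq_one_iff (x : D.GtpTheta)

/-- Its image is `Δ̄_Θ`. [cite: MochizukiEtTh2009, Def 2.1 p.35] -/
theorem modLDelta_range : (D.modLDelta l).range = D.DeltaThetaBar l := by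
  rw [modLDelta, MonoidHom.range_comp, Subgroup.range_subtype]
  rfl

variable {l}

/-- **`#Δ̄_Θ = l`** (from `[Δ_Θ : l·Δ_Θ] = l`, the cyclotome identification `Δ_Θ/l ≅ μ_l` at level `(1, l)`).
[cite: MochizukiEtTh2009, Def 2.1 p.35] -/
theorem natCard_DeltaThetaBar {l : ℕ+} (μ : D.CyclotomeMod 1 l) :
    Nat.card (D.DeltaThetaBar l) = l := by
  rw [← modLDelta_range, ← Subgroup.index_ker, modLDelta_ker]
  exact index_lDeltaTheta_of_cyclotomeMod μ

/-- **Squaring is bijective on `Δ̄_Θ`** (a finite group of odd order `l`).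
[cite: MochizukiEtTh2009, Def 2.1 p.35] -/
theorem sq_bijective_DeltaThetaBar {l : ℕ+} (μ : D.CyclotomeMod 1 l) (hl : Odd (l : ℕ)) :
    Function.Bijective fun a : D.DeltaThetaBar l => a ^ 2 := by
  have h : (Nat.card (D.DeltaThetaBar (l : ℕ))).Coprime 2 := by
    rw [D.natCard_DeltaThetaBar μ]
    exact Nat.coprime_two_right.mpr hl
  exact h.pow_left_bijective

/-- **`Δ̄_Θ` is discrete** in the topology induced from `(Π^tp_X)^Θ / l·Δ_Θ` (because `l·Δ_Θ` is open in
`Δ_Θ` and the projection is an open map). [cite: MochizukiEtTh2009, Def 2.1 p.35] -/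
theorem discreteTopology_DeltaThetaBar {l : ℕ+} (μ : D.CyclotomeMod 1 l) :
    DiscreteTopology (D.DeltaThetaBar l) := by
  apply discreteTopology_of_isOpen_singleton_one
  have hL := isOpen_lDeltaTheta_of_cyclotomeMod μ
  rw [isOpen_induced_iff] at hL
  obtain ⟨V, hV, hVL⟩ := hL
  have hmemV : ∀ y : D.DeltaTheta, (y : D.GtpTheta) ∈ V ↔ (y : D.GtpTheta) ∈ D.lDeltaTheta l := by
    intro y
    have e := Set.ext_iff.mp hVL y
    rw [Set.mem_preimage, SetLike.mem_coe, Subgroup.mem_subgroupOf] at e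
    exact e
  rw [isOpen_induced_iff]
  refine ⟨(D.modL l) '' V, QuotientGroup.isOpenMap_coe V hV, ?_⟩
  ext ⟨x, hx⟩
  obtain ⟨y, hy, rfl⟩ := hx
  rw [Set.mem_preimage, Set.mem_singleton_iff, Set.mem_image]
  constructor
  · rintro ⟨v, hv, hvy⟩
    have hvy' : v⁻¹ * y ∈ D.lDeltaTheta l := QuotientGroup.eq.mp hvy
    have hvΔ : v ∈ D.DeltaTheta := by
      have e : y * (v⁻¹ * y)⁻¹ = v := by group
      rw [← e]
      exact mul_mem hy (inv_mem (D.lDeltaTheta_le l hvy'))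
    have hvL : v ∈ D.lDeltaTheta l := (hmemV ⟨v, hvΔ⟩).mp hv
    have hyL : y ∈ D.lDeltaTheta l := by
      have e : v * (v⁻¹ * y) = y := by group
      rw [← e]
      exact mul_mem hvL hvy'
    apply Subtype.ext
    change D.modL l y = 1
    rw [QuotientGroup.mk'_apply, QuotientGroup.eq_one_iff]
    exact hyL
  · intro h1
    have hyL : y ∈ D.lDeltaTheta l := by
      have e : D.modL l y = 1 := congrArg Subtype.val h1
      rw [QuotientGroup.mk'_apply, QuotientGroup.eq_one_iff] at e
      exact e
    refine ⟨y, (hmemV ⟨y, hy⟩).mpr hyL, rfl⟩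

end ModL

/-! ### The chain `Π^tp_Ÿ ≤ Π^tp_Y ≤ Π^tp_X̲`: a lift of the `μ₂`-generator and the character `toZ/l` -/

/-- Under `K = K̈` there is an element of `Π^tp_Y` outside `Π^tp_Ÿ` (a lift of the generator of
`Gal(Ÿ/Y) ≅ μ₂`; `[Π^tp_Y : Π^tp_Ÿ] = 2`). [cite: MochizukiEtTh2009, Def 2.7 p.41] -/
theorem exists_mem_GtpY_not_mem_GtpYdd (hS : D.Sec2Hyps) : ∃ t₁ ∈ D.GtpY, t₁ ∉ D.GtpYdd := by
  by_contra h
  have h' : D.GtpY ≤ D.GtpYdd := fun x hx => by_contra fun hxN => h ⟨x, hx, hxN⟩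
  have h1 : D.GtpYdd.relIndex D.GtpY = 1 := Subgroup.relIndex_eq_one.mpr h'
  rw [relIndex_GtpYdd_GtpY hS] at h1
  exact absurd h1 (by norm_num)

/-- `Π^tp_Y = Π^tp_Ÿ ⊔ Π^tp_Ÿ·t₁` for any `t₁ ∈ Π^tp_Y ∖ Π^tp_Ÿ` (index two): two elements of `Π^tp_Y`
outside `Π^tp_Ÿ` differ by an element of `Π^tp_Ÿ`. [cite: MochizukiEtTh2009, Def 2.7 p.41] -/
theorem mul_inv_mem_GtpYdd (hS : D.Sec2Hyps) {h t₁ : D.PiTemp} (hh : h ∈ D.GtpY) (hhN : h ∉ D.GtpYdd)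
    (ht₁ : t₁ ∈ D.GtpY) (ht₁N : t₁ ∉ D.GtpYdd) : h * t₁⁻¹ ∈ D.GtpYdd := by
  have hidx : (D.GtpYdd.subgroupOf D.GtpY).index = 2 := relIndex_GtpYdd_GtpY hS
  have key := Subgroup.mul_mem_iff_of_index_two hidx (a := (⟨h, hh⟩ : D.GtpY))
    (b := (⟨t₁, ht₁⟩ : D.GtpY)⁻¹)
  rw [Subgroup.mem_subgroupOf, Subgroup.mem_subgroupOf, Subgroup.mem_subgroupOf, Subgroup.coe_mul,
    Subgroup.coe_inv, inv_mem_iff] at key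
  exact key.mpr (iff_of_false hhN ht₁N)

section Chi

variable (l : ℕ)

/-- The exponent of `h ∈ Π^tp_X̲` in `Π^tp_X̲/Π^tp_Y ≅ l·Z ≅ ℤ`: `toZ(h)/l`.
[cite: MochizukiEtTh2009, Def 2.7 p.41] -/
def zExpXu (h : D.GtpXu l) : ℤ := Multiplicative.toAdd (D.toZ (h : D.PiTemp)) / (l : ℤ)

/-- `toZ(h) = l · zExpXu(h)` on `Π^tp_X̲ = toZ⁻¹(l·Z)`. [cite: MochizukiEtTh2009, Def 2.7 p.41] -/
theorem toZ_eq_mul_zExpXu (hl : l ≠ 0) (h : D.GtpXu l) :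
    Multiplicative.toAdd (D.toZ (h : D.PiTemp)) = (l : ℤ) * D.zExpXu l h := by
  have hl' : (l : ℤ) ≠ 0 := by exact_mod_cast hl
  obtain ⟨k, hk⟩ : ∃ k : ℤ, Multiplicative.toAdd (D.toZ (h : D.PiTemp)) = l * k := by
    have hmem : D.toZ (h : D.PiTemp) ∈ lZ l := h.2
    rw [Subgroup.mem_zpowers_iff] at hmem
    obtain ⟨k, hk⟩ := hmem
    refine ⟨k, ?_⟩
    rw [← hk]
    simp [mul_comm]
  rw [zExpXu, hk, Int.mul_ediv_cancel_left _ hl']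

/-- **The character `Π^tp_X̲ → ℤ`, `h ↦ toZ(h)/l`** (the quotient `Π^tp_X̲ ↠ Π^tp_X̲/Π^tp_Y ≅ l·Z ≅ ℤ`).
[cite: MochizukiEtTh2009, Def 2.7 p.41] -/
def toZDivL (hl : l ≠ 0) : D.GtpXu l →* Multiplicative ℤ where
  toFun h := Multiplicative.ofAdd (D.zExpXu l h)
  map_one' := by simp [zExpXu]
  map_mul' a b := by
    have hl' : (l : ℤ) ≠ 0 := by exact_mod_cast hl
    rw [← ofAdd_add]
    congr 1
    apply mul_left_cancel₀ hl'
    rw [mul_add, ← D.toZ_eq_mul_zExpXu l hl, ← D.toZ_eq_mul_zExpXu l hl, ← D.toZ_eq_mul_zExpXu l hl,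
      Subgroup.coe_mul, map_mul, toAdd_mul]

/-- `Ker(Π^tp_X̲ → ℤ) = Π^tp_Y`. [cite: MochizukiEtTh2009, Def 2.7 p.41] -/
theorem toZDivL_eq_one_iff (hl : l ≠ 0) (h : D.GtpXu l) :
    D.toZDivL l hl h = 1 ↔ (h : D.PiTemp) ∈ D.GtpY := by
  have hl' : (l : ℤ) ≠ 0 := by exact_mod_cast hl
  change Multiplicative.ofAdd (D.zExpXu l h) = 1 ↔ (h : D.PiTemp) ∈ D.toZ.ker
  rw [MonoidHom.mem_ker, ← ofAdd_zero, Multiplicative.ofAdd.injective.eq_iff]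
  constructor
  · intro h0
    have e := D.toZ_eq_mul_zExpXu l hl h
    rw [h0, mul_zero] at e
    exact Multiplicative.toAdd.injective (by simpa using e)
  · intro h1
    have h2 : (l : ℤ) * D.zExpXu l h = 0 := by
      rw [← D.toZ_eq_mul_zExpXu l hl, h1]
      rfl
    exact (mul_eq_zero.1 h2).resolve_left hl'

/-- A lift `t ∈ Π^tp_X̲` of the generator `l ∈ l·Z`: `toZ(t)/l = 1` (`toZ` is onto).
[cite: MochizukiEtTh2009, Def 2.7 p.41] -/
theorem exists_toZDivL_eq (hl : l ≠ 0) :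
    ∃ (t : D.PiTemp) (ht : t ∈ D.GtpXu l), D.toZDivL l hl ⟨t, ht⟩ = Multiplicative.ofAdd 1 := by
  have hl' : (l : ℤ) ≠ 0 := by exact_mod_cast hl
  obtain ⟨t, htl⟩ := D.toZ_surjective (Multiplicative.ofAdd (l : ℤ))
  have ht : t ∈ D.GtpXu l := by
    change D.toZ t ∈ lZ l
    rw [htl]
    exact Subgroup.mem_zpowers _
  refine ⟨t, ht, ?_⟩
  change Multiplicative.ofAdd (D.zExpXu l ⟨t, ht⟩) = _
  congr 1
  apply mul_left_cancel₀ hl'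
  rw [← D.toZ_eq_mul_zExpXu l hl, mul_one]
  change Multiplicative.toAdd (D.toZ t) = _
  rw [htl]
  rfl

end Chi

/-! ### `η̈^Θ` modulo `l` and its invariance -/

namespace EtaleThetaData

variable {D} {E : D.EtaleThetaData}

/-- **Reduction modulo `l`**: `H¹(H, Δ_Θ) → H¹(H, Δ̄_Θ)` along `Δ_Θ → Δ_Θ/l·Δ_Θ` (the class
"`∈ H¹(Π^tp_Ÿ, Δ_Θ ⊗ ℤ/lℤ)`" of p. 41). [cite: MochizukiEtTh2009, Def 2.7 p.41] -/
abbrev redModL (l : ℕ) (H : Subgroup D.PiTemp) :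
    D.H1 H →* ContH1 (D.toThetaModL l) (D.DeltaThetaBar l) H :=
  ContH1.push D.toTheta D.DeltaTheta (D.modL l) (D.continuous_modL l) (D.DeltaThetaBar l) le_rfl H

/-- `H¹(H, Δ̄_Θ)` has exponent `l` (values in a group killed by `l`). [cite: MochizukiEtTh2009, Def 2.7 p.41] -/
theorem pow_eq_one_of_modL (l : ℕ) (H : Subgroup D.PiTemp)
    (x : ContH1 (D.toThetaModL l) (D.DeltaThetaBar l) H) : x ^ l = 1 := by
  induction x using QuotientGroup.induction_on with
  | H f =>
    have hf : f ^ l = 1 := by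
      apply Subtype.ext
      funext h
      rw [SubgroupClass.coe_pow, Pi.pow_apply, OneMemClass.coe_one, Pi.one_apply]
      exact D.DeltaThetaBar_pow_eq_one l (f.1 h)
    calc (QuotientGroup.mk f : ContH1 (D.toThetaModL l) (D.DeltaThetaBar l) H) ^ l
        = (QuotientGroup.mk (f ^ l) : ContH1 (D.toThetaModL l) (D.DeltaThetaBar l) H) := rfl
      _ = 1 := by rw [hf]; rfl

/-- **From invariance modulo `l`-th powers to honest invariance modulo `l`**: if
`σ·η̈^Θ = η̈^Θ · κ^l`, then `σ` fixes `η̈^Θ mod l ∈ H¹(Π^tp_Ÿ, Δ̄_Θ)`.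
[cite: MochizukiEtTh2009, Def 2.7 p.41] -/
theorem conj_redModL_etaDd_eq [D.GtpYdd.Normal] {l : ℕ} {S : Subgroup D.PiTemp}
    (hinv : ∀ σ ∈ S, ∃ κ : D.H1 D.GtpYdd,
      ContH1.conj D.toTheta D.DeltaTheta σ E.etaDd = E.etaDd * κ ^ l)
    {σ : D.PiTemp} (hσ : σ ∈ S) :
    ContH1.conj (D.toThetaModL l) (D.DeltaThetaBar l) σ (redModL l D.GtpYdd E.etaDd) =
      redModL l D.GtpYdd E.etaDd := by
  obtain ⟨κ, hκ⟩ := hinv σ hσ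
  rw [← ContH1.push_conj, hκ, map_mul, map_pow, pow_eq_one_of_modL, mul_one]

end EtaleThetaData

end ThetaSetting

end Literature.AnabelianGeometry.EtaleTheta

end
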